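import Summits.AtomisticToContinuum.Crystallization.Theses.NashClassCertificates
import Literature.MathematicalPhysics.StatisticalMechanics.MuGroundStateConfiguration
import HarnessLib

/-!
# Sketch — crux `NashTwoShellGap` (stmt-AtomisticToContinuum-16826), crux-ideate round 1, ideator k = 1

First lemmas of the two idea cards of this seat, typed over existing declarations only
(`siteEnergy`, `lennardJones`, `interactionEnergy`, `PeriodicConfiguration.energyPerParticle`,
`IsTwoShellGood`, `IsTwoShellGoodSet`, `BallMatch`).  Nothing is proved here; every `def … : Prop`
must elaborate (rc 0, no `sorry`).

* card `nash-limit-dichotomy`  — `IsNashSet`, `NashLimitClosed` (first lemma), `IsTwoShellGoodCut`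
  (definition request D1: the goodness predicate with a free cut-off radius, needed for the
  two-tolerance hysteresis of the extraction lemma), `closureBad_subset` (the hysteresis lemma).
* card `equilibrium-defect-gap` — `BadClustered`, `SupercellDefectGap` (first lemma).
-/

noncomputable section

namespace Summit.AtomisticToContinuum.Crystallization.Cruxes.NashTwoShellGap.IdeasK1

open scoped BigOperators Classical
open Literature.MathematicalPhysics.StatisticalMechanics Literature.Geometry.DiscreteGeometry

/-- Euclidean 3-space. -/
abbrev E3 := EuclideanSpace ℝ (Fin 3)

/-! ## The Nash class, finite and infinite -/

/-- The crux's Nash clause for a finite configuration (verbatim): no particle lowers the energy by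
relocating to a point distinct from the other particles. [folklore] -/
def IsNashFin {N : ℕ} (x : Fin N → E3) : Prop :=
  ∀ (i : Fin N) (y : E3), (∀ j : Fin N, j ≠ i → y ≠ x j) →
    siteEnergy lennardJones x i ≤ ∑ j ∈ Finset.univ.erase i, lennardJones (dist y (x j))

/-- `δ`-separation of a finite configuration (the crux's hypothesis at `δ = 1/3`). [folklore] -/
def SepFin (δ : ℝ) {N : ℕ} (x : Fin N → E3) : Prop :=
  ∀ i j : Fin N, i ≠ j → δ ≤ dist (x i) (x j)

/-- **Infinite Nash equilibrium**: no point `p` of the locally finite set `X ⊆ ℝ³` lowers its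
Lennard-Jones field energy `∑_{q ∈ X, q ≠ p} V(|p − q|)` by relocating to a point `y` distinct from
the other points (the `(n, k) = (1, 1)`, `μ`-free case of Sütő's `IsMuGSC`; the sums are absolutely
convergent for uniformly discrete `X` in `d = 3`, `UniformlyDiscrete.summable_lennardJones_dist`).
[folklore] -/
def IsNashSet (X : Set E3) : Prop :=
  ∀ p ∈ X, ∀ y : E3, (∀ q ∈ X, q ≠ p → y ≠ q) →
    ∑' q : {q : E3 // q ∈ X ∧ q ≠ p}, lennardJones (dist p q.1)
      ≤ ∑' q : {q : E3 // q ∈ X ∧ q ≠ p}, lennardJones (dist y q.1)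

/-- **FIRST LEMMA of card `nash-limit-dichotomy` — the Nash class is closed under local limits.**
If a `1/3`-separated set `X ⊆ ℝ³` is, on every ball `B_R(0)` and to every precision `ε > 0`,
two-way `ε`-matched (`BallMatch`) by some finite `1/3`-separated NASH configuration, then `X` is an
infinite Nash equilibrium.  (Proof route: fix `p ∈ X`, a free `y`, truncate both LJ fields at radius
`L`; the tails are `≤ C L⁻³` uniformly by separation (`sum_inv_pow_six_le_of_forall_le_dist`); on
`B_L` the finite Nash inequality of the approximants passes to the limit by continuity of `V` away
from `0`.)  Size M. [folklore] -/
def NashLimitClosed : Prop :=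
  ∀ X : Set E3, (∀ p ∈ X, ∀ q ∈ X, p ≠ q → (1 / 3 : ℝ) ≤ dist p q) →
    (∀ R ε : ℝ, 0 < ε → ∃ (N : ℕ) (x : Fin N → E3),
        SepFin (1 / 3) x ∧ IsNashFin x ∧ BallMatch ε R (0 : E3) (Set.range x) X) →
    IsNashSet X

/-! ## Definition request D1 and the hysteresis lemma (badness is not a closed condition) -/

/-- **D1 — two-shell goodness with a free cut-off radius** `c·a` (the tree's `IsTwoShellGoodSet` is
the case `c = 3/2`): `q ∈ Y` has an `ε`-matched fcc/hcp two-shell environment at a scale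
`a ∈ [aLo, aHi]`, and EVERY point of `Y ∖ {q}` within `c·a` of `q` is one of the `18` matched points.
Monotone: antitone in `c`, monotone in `ε`. [folklore] -/
def IsTwoShellGoodCut (ε c aLo aHi : ℝ) (Y : Set E3) (q : E3) : Prop :=
  ∃ a : ℝ, aLo ≤ a ∧ a ≤ aHi ∧
    ∃ (A : E3 →ₗᵢ[ℝ] E3) (P : Finset E3) (f : E3 → E3),
      (P = fccTwoShellPattern ∨ P = hcpTwoShellPattern) ∧
      (∀ v ∈ P, f v ∈ Y ∧ dist (f v) (q + a • A v) ≤ ε * a) ∧ Set.InjOn f ↑P ∧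
      ∀ y ∈ Y, y ≠ q → dist y q ≤ c * a → ∃ v ∈ P, f v = y

/-- **Hysteresis lemma** (used by the extraction lemma of card `nash-limit-dichotomy`; badness at
`(1/20, 3/2)` is an OPEN condition, so the portmanteau step needs a closed enlargement): a local
limit of rooted configurations whose root is `(1/20, 3/2)`-bad has a root that is NOT
`(9/200, 38/25)`-good — for every `ε' < 1/20` and every cut-off `c' > 3/2` in fact; the constants are
the ones the cards use.  Stated for rooted sets (root `0`). Size S/M. [folklore] -/
def ClosureBadSubset : Prop :=
  ∀ X : Set E3, (0 : E3) ∈ X → (∀ p ∈ X, ∀ q ∈ X, p ≠ q → (1 / 3 : ℝ) ≤ dist p q) →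
    (∀ R δ : ℝ, 0 < δ → ∃ Y : Set E3, (0 : E3) ∈ Y ∧ (∀ p ∈ Y, ∀ q ∈ Y, p ≠ q → (1 / 3 : ℝ) ≤ dist p q) ∧
        ¬ IsTwoShellGoodSet (1 / 20) (47 / 50) 1 Y 0 ∧ BallMatch δ R (0 : E3) Y X) →
    ¬ IsTwoShellGoodCut (9 / 200) (38 / 25) (47 / 50) 1 X 0

/-! ## Card `equilibrium-defect-gap`: isolated compact defects in periodic Nash equilibria -/

/-- Badness of a periodic configuration is **`D`-clustered**: any two `(1/20)`-bad points are either
within `D` of each other or at least `4D` apart — so the bad set is a union of clusters of diameter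
`≤ D`, pairwise `≥ 3D` apart (compact, isolated defects; grain boundaries, dislocation lines and bulk
bad phases are excluded by design — they belong to the bulk/extended branch). [folklore] -/
def BadClustered (D : ℝ) (P : PeriodicConfiguration 3) : Prop :=
  ∀ y ∈ P.points, ∀ z ∈ P.points,
    ¬ IsTwoShellGoodSet (1 / 20) (47 / 50) 1 P.points y →
    ¬ IsTwoShellGoodSet (1 / 20) (47 / 50) 1 P.points z →
      dist y z ≤ D ∨ 4 * D ≤ dist y z

/-- **FIRST LEMMA of card `equilibrium-defect-gap` — the supercell defect gap.**  There are `D > 0`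
and `ω > 0` such that every periodic configuration of `ℝ³` with `1/3`-separated point set which is an
infinite NASH equilibrium and whose badness is `D`-clustered pays `ω` per bad motif point:
`ω · #{y ∈ motif : y bad} ≤ #motif · (e(P) − e⋆)`.  The right side is the excess energy PER CELL; since
`e⋆ ≤ e(host)` for the Barlow host of the cell, it suffices to bound the `e⋆`-FREE formation energy
`E_cell(P) − #motif · e(host)` from below — the quantity computed in every supercell defect calculation,
whose convergence in the cell size (rate `L⁻³`) is the periodic-cell theorem of
Ehrlacher–Ortner–Shapeev.  Numbers (tree units, `ε_well = 1/12`): relaxed vacancy `≈ 0.65` for `18` bad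
neighbours (`ω ≲ 0.036`), self-interstitial `> 1`, small icosahedral inclusion `≳ 0.4`; the rattler
(`2·10⁻³`) is not an equilibrium and does not occur.  Size XL (contains the small-defect zoo), but
finite-dimensional and certifiable by interval Newton on cores of diameter `≤ D` plus decay bounds.
[cite: EhrlacherOrtnerShapeev2016, Theorem 2 (periodic cells)] -/
def SupercellDefectGap : Prop :=
  ∃ D ω : ℝ, 0 < D ∧ 0 < ω ∧ ∀ P : PeriodicConfiguration 3,
    (∀ u ∈ P.points, ∀ v ∈ P.points, u ≠ v → (1 / 3 : ℝ) ≤ dist u v) →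
    IsNashSet P.points → BadClustered D P →
      ω * ((P.motif.filter fun y => ¬ IsTwoShellGoodSet (1 / 20) (47 / 50) 1 P.points y).card : ℝ)
        ≤ (P.motif.card : ℝ) *
          (P.energyPerParticle lennardJones -
            ⨅ Q : PeriodicConfiguration 3, Q.energyPerParticle lennardJones)

/-! ## Sanity: the finite Nash clause is the crux's, so ground states are in the class -/

/-- The route's support `GroundStatesAreNash` is literally `IsGroundState → IsNashFin`. [folklore] -/
theorem isNashFin_of_groundStatesAreNash
    (h : Summit.AtomisticToContinuum.Crystallization.Theses.NashClassCertificates.GroundStatesAreNash)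
    {N : ℕ} (x : Fin N → E3) (hx : IsGroundState lennardJones x) : IsNashFin x :=
  h N x hx

/-- The crux, restated through the abbreviations of this file (definitional). [folklore] -/
theorem nashTwoShellGap_iff :
    Summit.AtomisticToContinuum.Crystallization.Theses.NashClassCertificates.NashTwoShellGap ↔
      ∃ g : ℝ, 0 < g ∧ ∀ (N : ℕ) (x : Fin N → E3), SepFin (1 / 3) x → IsNashFin x →
        (N : ℝ) * (⨅ Q : PeriodicConfiguration 3, Q.energyPerParticle lennardJones) +
            g * (Nat.card {i : Fin N // ¬ IsTwoShellGood (1 / 20) (47 / 50) 1 x i} : ℝ) ≤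
          interactionEnergy lennardJones x :=
  Iff.rfl

end Summit.AtomisticToContinuum.Crystallization.Cruxes.NashTwoShellGap.IdeasK1

end
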